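/-
Copyright (c) 2026 the pub-hodgecm-mathlib formalisation cell (harness21).  Prover seat hodgecm-mathlib-LH7-p09 (g2), CLOSE-OUT ROSTER strike line L3∕L5 (Track A
«(D-RAM) FOUR-FRAME» squad F0∕P3c∕LH4 ∕ F0∕P3c∕LH7); β₂-BOARD v2 row (OFF) (lead LH7-p09 (g2); assembler LH4-p12 (g8) ED. 5 `…OffRowOfPiecesResidual`, socket `hL`, RAY band);
helper lane on h413 = stmt-HodgeConjecture-24833 (count-neutral).  2026-09-05.
-/
import Summits.HodgeConjecture.HodgeConjecture.Theorems.F0P3cDyRamRayScalarNearlyFixed    -- ★ (LH4-p16 (g2)): `exists_fixed_unit_valueSet_endoGL_sub_one_glued_eq_smul_xPlus` (the σ-fixed-unit ray HEAD)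
import Summits.HodgeConjecture.HodgeConjecture.Theorems.F0P3cDyRamLowerLineRayLetters    -- ★ p863440 (this seat): `v_rayScalar_eq_of_line`, `isOrd_div_pow_of_line`; brings ★ p863123 `isOrd_div_pow_mul_of_deep_level`
import HarnessLib

/-!
# Crux `H413`, line LH4 «(D-RAM) FOUR-FRAME» — the (β₂) road (R-36), β₂-BOARD v2 row (OFF), socket `hL`, RAY band: «EVERY VERTEX OF THE LOWER LINE WITH `m* ≤ b + ℓ₀` IS A
# `σ`-FIXED-UNIT RAY» — LH4-p16 (g2)'s HEAD ★ `…RayScalarNearlyFixed.exists_fixed_unit_valueSet_endoGL_sub_one_glued_eq_smul_xPlus` with its five cell-dependent letters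
# (`hμ hμt hmm hP he₀v hsk`) DISCHARGED from the lower-line size letters of ★ p863269∕p863440

Cell `hodgecm-mathlib` (D-0151), FLOOR 0, crux item H413 = `stmt-HodgeConjecture-24833`, route of record `HCCMUnconditional`; squads F0∕P3c∕LH4 ∕ LH7; lane
`--supports stmt-HodgeConjecture-24833 --as helper` (count-neutral; pays NO tier-0 row).  THEOREMS ONLY (no `def`, no instance, no notation, no `sorry`, default heartbeats);
★-only imports; states NO law; (β₂) stays a HYPOTHESIS.  Frame = ★ p16's HEAD VERBATIM (★ p861372 HEAD B + the sheet datum `IsRamifiedQuadraticDatum σ ϖ d t` on `E` + ★ (C1)'s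
line model), with the ray-domination ∕ population ∕ shell ∕ skew letters replaced by the LOWER-LINE letters in the cell's currency.

WHY (BETA2-OFF-RESIDUAL v1 §2, `F0/P3c/LH7/LH7-p09/g2/`).  After ★ p863269∕p863399 the (OFF) socket `hL` is the pure label balance on the lower line `j + b + ℓ₀ = jl′`
(`2b + ℓ₀ < m₀`, `b < j`, `ℓ₀ = d % 2`).  On its RAY band `m* ≤ b + ℓ₀` the depth element is ray-dominated at the modulus `b + ℓ₀` (★ p863440 `isOrd_div_pow_of_line`), the ray
scalar is on the `ℓ₀`-shell (★ p863440 `v_rayScalar_eq_of_line`), the population token `μ∕Y ∈ 𝒪_cc` is the cell's depth clause (★ p863123 at `L = 0`), and the skew token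
`|μ∕Y|·|lam − ρlam| ≤ |ϖE|^{2b+2ℓ₀+1}·|cc(α − ρα)|` beats the HEAD's threshold `3d − 2 + d%2` BECAUSE of the band (`b ≥ 2d − 1`).  So p16's HEAD applies: the census letter
of EVERY glued vertex over such a cell is `valueSetMod σ ϖ m* (e′ • X₊)` for a `σ`-fixed unit `e′` with `|e₀ − e′·t₊| ≤ |ϖ|^{m*}` — the vertex is LABELLED, by `ω(e′)` (★ p861154
`valueSetMod_smul_xPlus_eq_plus_iff_exists_norm`), and `hL` on the RAY band is the balance of `ω(e′(Λ))` against the weight over `levelSet(j, b)` (LH4-p19 (g2)'s digit engine).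
* HEAD `exists_fixed_unit_valueSet_eq_smul_xPlus_of_line` — p16's frame binders VERBATIM up to `hYO`, then the LOWER-LINE letters `hYb : |Y| = |ϖE|^b`, `hcb : |cc| < |ϖE|^b`,
  `hμle : |μ| ≤ |ϖE|^{2b+d%2+1}`, `hanti : |μ − ρμ| = |cc(α − ρα)|·|ϖE|^{b+d%2}`, `hband : mstarOfRecord d ≤ b + d % 2`, the structure letters `hΘlam hvlam huu`, the ray scalar `he₀`,
  and the two deep tokens at ANY level `N ≥ 3d − 2 + d%2` (`hlamN`, `huN`) ⟹ p16's conclusion VERBATIM.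
HONEST LABEL.  Count-neutral composition; nothing printed is asserted; no census law is stated; the balance `hL` stays OPEN; `HC_CM` is proved only modulo the 7 printed citations
(2 remaining named inputs: hLiu418 = `stmt-HodgeConjecture-24832`, h413 = `stmt-HodgeConjecture-24833`) until rung 0 closes.
## References
* [Rogawski1990] J. D. Rogawski, *Automorphic Representations of Unitary Groups in Three Variables*, Ann. of Math. Stud. 123 (1990): §4.9 Prop. 4.9.1 (b) p. 55.
* [Jacobowitz1962] R. Jacobowitz, *Hermitian forms over local fields*, Amer. J. Math. 84 (1962): §4 (duals, gluing).
* [Kottwitz1986BaseChangeUnits] R. E. Kottwitz, *Base change for unit elements of Hecke algebras*, Compositio Math. 60 (1986): §1 pp. 240–241.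
* [Serre1979] J.-P. Serre, *Local Fields*, GTM 67 (1979): Ch. III §6 Prop. 12; Ch. V §3 Cor. 3 (norm classes of units).
-/

set_option autoImplicit false

noncomputable section

namespace Summit.HodgeConjecture.HodgeConjecture.Cruxes.H413.F0P3cDyRamLowerLineRayVertex

open scoped Valued WithZero Matrix MatrixGroups
open WithZero
open Literature.NumberTheory.Automorphic Literature.NumberTheory.Automorphic.HermitianLattice Literature.NumberTheory.Automorphic.UnitaryLatticeTree
open Literature.NumberTheory.Automorphic.UnitaryThreeFourFrame (IsRamifiedQuadraticDatum)
open Literature.NumberTheory.Rogawski1990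
open Summit.HodgeConjecture.HodgeConjecture.Cruxes.H413.F0P3cDyRamFourFramePieces
open Summit.HodgeConjecture.HodgeConjecture.Cruxes.H413.F0P3cDyRamToricCensusDefs
open Summit.HodgeConjecture.HodgeConjecture.Cruxes.H413.F0P3cDyRamBoundaryCellLetterCardTwo (v_map_lt_one_iff_of_le_iff)
open Summit.HodgeConjecture.HodgeConjecture.Cruxes.H413.F0P3cDyRamRayDominatedCellLetter (v_map_le_map_pow_of_le)
open Summit.HodgeConjecture.HodgeConjecture.Cruxes.H413.F0P3cDyRamRayScalarNearlyFixed (exists_fixed_unit_valueSet_endoGL_sub_one_glued_eq_smul_xPlus)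
open Summit.HodgeConjecture.HodgeConjecture.Cruxes.H413.F0P3cDyRamDeepConeCellOffShellLevel (isOrd_div_pow_mul_of_deep_level)
open Summit.HodgeConjecture.HodgeConjecture.Cruxes.H413.F0P3cDyRamLowerLineRayLetters (v_rayScalar_eq_of_line isOrd_div_pow_of_line eq_map_pow_mul_div_pow)

variable {E M : Type} [Field E] [Valued E ℤᵐ⁰] [Field M] [Valued M ℤᵐ⁰] {ρ Θ : M →+* M} {α : M}

/-- **HEAD — «EVERY VERTEX OF THE LOWER LINE WITH `m* ≤ b + ℓ₀` IS A `σ`-FIXED-UNIT RAY».**  ★ `…RayScalarNearlyFixed`'s HEAD frame VERBATIM (sheet datum on `E`, block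
`(H₂, h)`, line model, glued vertex `L` over `Λ = x₀·𝒪_cc` with `φ w₀ = Y⁻¹x₀`, `Y = dualGen ρ Θ α cc h_M x₀ ∈ 𝒪_cc`, `Θlam·lam = 1`, `|lam| = 1`, `u₀₀·σu₀₀ = 1`, the ray scalar
`jE e₀ = Tr_ρ(μ∕(cc(α − ρα)·ΘY))`), then the LOWER-LINE letters in the cell's currency: `hYb : |Y| = |ϖE|^b`, `hcb : |cc| < |ϖE|^b` (`b < j`), `hμle : |μ| ≤ |ϖE|^{2b+d%2+1}` (below the
row), `hanti : |μ − ρμ| = |cc(α − ρα)|·|ϖE|^{b+d%2}` (the line `j + b + d%2 = jl′`), the RAY BAND `hband : m* ≤ b + d % 2`, and the deep tokens `|lam − 1| ≤ |ϖE|^N`, `|u₀₀ − 1| ≤ |ϖ|^N`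
at any `N ≥ 3d − 2 + d%2`.  THEN there is a `σ`-fixed unit `e′` with `|e₀ − e′·t₊| ≤ |ϖ|^{m*}` and `VS_{m*}(Γ − 1 | L) = valueSetMod σ ϖ m* (e′ • X₊)`.
[cite: Rogawski1990, §4.9 Prop. 4.9.1 (b) p. 55] [cite: Jacobowitz1962, §4] [cite: Kottwitz1986BaseChangeUnits, §1 pp. 240–241] [cite: Serre1979, Ch. V §3 Cor. 3] -/
theorem exists_fixed_unit_valueSet_eq_smul_xPlus_of_line {σ : E →+* E} {ϖ : E} {d t : ℕ} (hD : IsRamifiedQuadraticDatum σ ϖ d t)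
    (H₂ : Matrix (Fin 2) (Fin 2) E) (h : E)
    (jE : E →+* M) (hjv : ∀ c, Valued.v (jE c) ≤ 1 ↔ Valued.v c ≤ 1) (hjfix : ∀ z, ρ z = z ↔ ∃ c, jE c = z)
    (hρρ : ∀ x, ρ (ρ x) = x) (hvρ : ∀ x, Valued.v (ρ x) = Valued.v x) (hα : ρ α ≠ α) (hα1 : Valued.v α ≤ 1)
    (hintρ : ∀ z : M, Valued.v z ≤ 1 → Valued.v ((z - ρ z) / (α - ρ α)) ≤ 1)
    (hΘΘ : ∀ x, Θ (Θ x) = x) (hΘρ : ∀ x, Θ (ρ x) = ρ (Θ x)) (hvΘ : ∀ x, Valued.v (Θ x) = Valued.v x) (hΘj : ∀ c, Θ (jE c) = jE (σ c))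
    (φ : (Fin 2 → E) →+ M) (hφs : ∀ (c : E) (x : Fin 2 → E), φ (c • x) = jE c * φ x)
    {γ₂ : GL (Fin 2) E} {lam hM : M} (hφγ : ∀ x, φ ((γ₂ : Matrix (Fin 2) (Fin 2) E) *ᵥ x) = lam * φ x) (hhM : hM ≠ 0) (hΘh : Θ hM = hM)
    (hform : ∀ x y, jE (pairing σ H₂ x y) = hM * Θ (φ x) * φ y + ρ (hM * Θ (φ x) * φ y))
    {L : Submodule 𝒪[E] (Fin 3 → E)} {b : ℕ} (hpr : ∀ x ∈ L, Valued.v (x 1) * Valued.v ϖ ^ b ≤ 1)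
    (hint : ∀ y ∈ L, Valued.v (pairing σ (!![H₂ 0 0, 0, H₂ 0 1; 0, h, 0; H₂ 1 0, 0, H₂ 1 1] : Matrix (Fin 3) (Fin 3) E) y y) ≤ 1)
    {B₂ : Submodule 𝒪[E] (Fin 2 → E)} {w₀ : Fin 2 → E} {g₀ : Fin 3 → E}
    (hB : B₂.map ((Matrix.toLin' (!![1, 0; 0, 0; 0, 1] : Matrix (Fin 3) (Fin 2) E)).restrictScalars 𝒪[E]) =
      L ⊓ LinearMap.ker ((LinearMap.proj (1 : Fin 3) : (Fin 3 → E) →ₗ[E] E).restrictScalars 𝒪[E]))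
    (hg₀ : g₀ ∈ L) (hg₀1 : Valued.v (g₀ 1) * Valued.v ϖ ^ b = 1) (hprg : g₀ - Pi.single 1 (g₀ 1) = ![w₀ 0, 0, w₀ 1])
    (u : GL (Fin 1) E)
    {cc x₀ : M} (hc : ρ cc = cc) (hc0 : cc ≠ 0) (hc1 : Valued.v cc ≤ 1) (hcc : cc * (α - ρ α) ≠ 0) (hx₀ : x₀ ≠ 0)
    {Λ : AddSubgroup M} (hBΛ : B₂.toAddSubgroup.map φ = Λ)
    (hΛx : ∀ x, x ∈ Λ ↔ ∃ ζ, IsOrd ρ α cc ζ ∧ x = x₀ * ζ) (hw₀Y : φ w₀ = (dualGen ρ Θ α cc hM x₀)⁻¹ * x₀)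
    (hYO : IsOrd ρ α cc (dualGen ρ Θ α cc hM x₀))
    -- the LOWER-LINE letters (cell currency)
    (hYb : Valued.v (dualGen ρ Θ α cc hM x₀) = Valued.v (jE ϖ) ^ b) (hcb : Valued.v cc < Valued.v (jE ϖ) ^ b)
    (hμle : Valued.v (lam - jE ((u : Matrix (Fin 1) (Fin 1) E) 0 0)) ≤ Valued.v (jE ϖ) ^ (2 * b + d % 2 + 1))
    (hanti : Valued.v ((lam - jE ((u : Matrix (Fin 1) (Fin 1) E) 0 0)) - ρ (lam - jE ((u : Matrix (Fin 1) (Fin 1) E) 0 0))) =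
      Valued.v (cc * (α - ρ α)) * Valued.v (jE ϖ) ^ (b + d % 2))
    (hband : mstarOfRecord d ≤ b + d % 2)
    -- the line-model structure, the ray scalar, the deep tokens at any level `N ≥ 3d − 2 + d%2`
    (hΘlam : Θ lam * lam = 1) (hvlam : Valued.v lam = 1)
    (huu : ((u : Matrix (Fin 1) (Fin 1) E) 0 0) * σ ((u : Matrix (Fin 1) (Fin 1) E) 0 0) = 1)
    {e₀ : E} (he₀ : jE e₀ = (lam - jE ((u : Matrix (Fin 1) (Fin 1) E) 0 0)) / (cc * (α - ρ α) * Θ (dualGen ρ Θ α cc hM x₀)) +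
      ρ ((lam - jE ((u : Matrix (Fin 1) (Fin 1) E) 0 0)) / (cc * (α - ρ α) * Θ (dualGen ρ Θ α cc hM x₀))))
    {N : ℕ} (hN : 3 * d - 2 + d % 2 ≤ N)
    (hlamN : Valued.v (lam - 1) ≤ Valued.v (jE ϖ) ^ N) (huN : Valued.v ((u : Matrix (Fin 1) (Fin 1) E) 0 0 - 1) ≤ Valued.v ϖ ^ N) :
    ∃ e' : E, σ e' = e' ∧ Valued.v e' = 1 ∧
      Valued.v (e₀ - e' * ((ϖ - σ ϖ) * ((ϖ * σ ϖ) ^ ((d - d % 2) / 2))⁻¹)) ≤ Valued.v ϖ ^ mstarOfRecord d ∧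
      {z : E | ∃ y ∈ L, Valued.v ((ϖ ^ mstarOfRecord d)⁻¹ * (z - pairing σ (!![H₂ 0 0, 0, H₂ 0 1; 0, h, 0; H₂ 1 0, 0, H₂ 1 1] : Matrix (Fin 3) (Fin 3) E) y
          ((((endoGL (γ₂, u) : GL (Fin 3) E) : Matrix (Fin 3) (Fin 3) E) - 1) *ᵥ y))) ≤ 1} =
        valueSetMod σ ϖ (mstarOfRecord d) (e' • xPlus σ ϖ d) := by
  obtain ⟨-, -, hϖ, -, -, -, -⟩ := id hD
  have hm : mstarOfRecord d = d % 2 + 2 * d - 1 := rfl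
  have hvϖ0 : Valued.v ϖ ≠ 0 := by rw [hϖ]; exact exp_ne_zero
  have hϖ0 : ϖ ≠ 0 := fun h0 => hvϖ0 (by rw [h0, map_zero])
  have hϖlt : Valued.v ϖ < 1 := by rw [hϖ, ← exp_zero, exp_lt_exp]; norm_num
  have hjϖ0 : jE ϖ ≠ 0 := (map_ne_zero jE).2 hϖ0
  have hvjϖ0 : Valued.v (jE ϖ) ≠ 0 := (Valuation.ne_zero_iff _).2 hjϖ0
  have hvjϖpos : 0 < Valued.v (jE ϖ) := zero_lt_iff.2 hvjϖ0
  have hjϖle : Valued.v (jE ϖ) ≤ 1 := ((v_map_lt_one_iff_of_le_iff jE hjv ϖ).2 hϖlt).le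
  have hρϖ : ρ (jE ϖ) = jE ϖ := (hjfix _).2 ⟨ϖ, rfl⟩
  set Y : M := dualGen ρ Θ α cc hM x₀ with hYdef
  set μ : M := lam - jE ((u : Matrix (Fin 1) (Fin 1) E) 0 0) with hμdef
  have hY0 : Y ≠ 0 := fun h0 => by
    rw [h0, Valuation.map_zero] at hYb
    exact pow_ne_zero b hvjϖ0 hYb.symm
  have hvYpos : 0 < Valued.v Y := zero_lt_iff.2 ((Valuation.ne_zero_iff _).2 hY0)
  -- ray domination at `m′ := b + d % 2`
  have hμt : IsOrd ρ α cc (μ / jE ϖ ^ (b + d % 2)) := isOrd_div_pow_of_line hρϖ hjϖ0 hjϖle (d % 2) hμle hanti.le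
  have hμ : μ = jE (ϖ ^ (b + d % 2)) * (μ / jE ϖ ^ (b + d % 2)) := eq_map_pow_mul_div_pow jE hjϖ0 μ (b + d % 2)
  -- the population token `μ∕Y ∈ 𝒪_cc` (the cell's depth clause, ★ p863123 at `L = 0`)
  have hP : IsOrd ρ α cc (μ / Y) := by
    have h0 := isOrd_div_pow_mul_of_deep_level hvρ hα hα1 jE hjv hϖ hρϖ hYO hYb hcb.le 0
      (hμle.trans (pow_le_pow_right_of_le_one' hjϖle (by omega))) (hanti.le.trans (mul_le_mul_right (pow_le_pow_right_of_le_one' hjϖle (by omega)) _))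
    rwa [pow_zero, one_mul] at h0
  -- the ray scalar on the `ℓ₀`-shell
  have he₀v : Valued.v e₀ = Valued.v ϖ ^ (d % 2) :=
    v_rayScalar_eq_of_line hρρ hvρ hα hα1 hΘρ hvΘ jE hjv hϖ hc hc0 hYO hYb hcb (d % 2) hμle hanti he₀
  -- the deep tokens at `n := 3d − 2 + d%2` and the skew token from the band
  have hlamn : Valued.v (lam - 1) ≤ Valued.v (jE ϖ) ^ (3 * d - 2 + d % 2) := hlamN.trans (pow_le_pow_right_of_le_one' hjϖle hN)
  have hun : Valued.v ((u : Matrix (Fin 1) (Fin 1) E) 0 0 - 1) ≤ Valued.v ϖ ^ (3 * d - 2 + d % 2) := huN.trans (pow_le_pow_right_of_le_one' hϖlt.le hN)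
  have hsk : Valued.v (μ / Y) * Valued.v (lam - ρ lam) ≤ Valued.v (jE ϖ) ^ (3 * d - 2 + d % 2) * Valued.v (cc * (α - ρ α)) := by
    have e : lam - ρ lam = μ - ρ μ := by
      rw [hμdef, map_sub, (hjfix _).2 ⟨_, rfl⟩]; ring
    rw [e, hanti, Valuation.map_div, hYb]
    have h1 : Valued.v μ / Valued.v (jE ϖ) ^ b ≤ Valued.v (jE ϖ) ^ (b + d % 2 + 1) := by
      rw [div_le_iff₀ (pow_pos hvjϖpos _), ← pow_add]
      exact hμle.trans (le_of_eq (by congr 1; omega))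
    calc Valued.v μ / Valued.v (jE ϖ) ^ b * (Valued.v (cc * (α - ρ α)) * Valued.v (jE ϖ) ^ (b + d % 2))
        ≤ Valued.v (jE ϖ) ^ (b + d % 2 + 1) * (Valued.v (cc * (α - ρ α)) * Valued.v (jE ϖ) ^ (b + d % 2)) := mul_le_mul_left h1 _
      _ = Valued.v (jE ϖ) ^ (2 * b + 2 * (d % 2) + 1) * Valued.v (cc * (α - ρ α)) := by
          rw [show 2 * b + 2 * (d % 2) + 1 = (b + d % 2 + 1) + (b + d % 2) by omega, pow_add (Valued.v (jE ϖ)) (b + d % 2 + 1) (b + d % 2)]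
          ac_rfl
      _ ≤ Valued.v (jE ϖ) ^ (3 * d - 2 + d % 2) * Valued.v (cc * (α - ρ α)) :=
          mul_le_mul_left (pow_le_pow_right_of_le_one' hjϖle (by rw [hm] at hband; omega)) _
  exact exists_fixed_unit_valueSet_endoGL_sub_one_glued_eq_smul_xPlus hD H₂ h jE hjv hjfix hρρ hvρ hα hα1 hintρ hΘΘ hΘρ hvΘ hΘj φ hφs hφγ hhM hΘh hform hpr hint hB hg₀
    hg₀1 hprg u hc hc0 hc1 hcc hx₀ hBΛ hΛx hw₀Y hYO hμ hμt hband hΘlam hvlam huu hP he₀ he₀v le_rfl hlamn hun hsk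

end Summit.HodgeConjecture.HodgeConjecture.Cruxes.H413.F0P3cDyRamLowerLineRayVertex

end
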